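/-
Copyright (c) 2026 the pub-hodgecm-mathlib formalisation cell (harness21).  Prover seat hodgecm-mathlib-K2Liu-p27 (g2), Track B «K2-LIT»,
#184♮ = hLiu418 = `stmt-HodgeConjecture-24832`; RULING M-158u + BATCH #129 (3)∕#131 (LEAD F0P6-plan (g14)): F4 (G-gen) B3 split — «p27 keeps the
induction core, R90-C10-p03 (g0) the place-assembly side».  THIS FILE = the induction core, GENERIC (places abstract).
THEOREMS ONLY (no `def`, no `instance`, no notation, no named-fact hypothesis, no `sorry`); lane `--supports stmt-HodgeConjecture-24832 --as helper`.
-/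
import Mathlib.Data.Fintype.Basic
import Mathlib.Data.Finset.Basic
import Mathlib.Logic.Function.Basic
import Summits.HodgeConjecture.HodgeConjecture.Theorems.K2LiuLocalThetaCyclicUniform   -- ★ (E-f) (ED. 2 import): `induction_on_kFinite_fun`
import HarnessLib

/-!
# Crux `HLiu418`, organ F4 (G-gen), B3 CORE: THE PLACE-FINSET INDUCTION — a property of place-tuples of one-place data which holds at the all-vacuum
# tuple and is, AT EACH PLACE SEPARATELY, carried from the vacuum to every datum (the other places frozen) holds at every tuple

Cell `hodgecm-mathlib`, crux item hLiu418 = `stmt-HodgeConjecture-24832` (helper lane `--supports`, count-neutral; closes no socket).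

B3 `K2LiuArchSWDataInduction` (= K2Liu-p10 (g6)'s FACE-G letter L3 `hGgen`, ★ p862960 `faceG_of_organs`' third organ) is proved place by place: the
archimedean datum is (after the polynomial partner (E-g) and the place-box tensor ★ `archBoxTensor`) a TUPLE `a : Π σ, D σ` of one-place Fock-finite data over
the finite set of real places; ★ (E-f) `K2LiuLocalThetaCyclicUniform.induction_on_kFinite[_fun]` is the ONE-PLACE STEP «`Good₁ (φ° σ) → Good₁ v` for every
one-place datum `v`» for any `Good₁` with the right closure properties (there: `Good₁ v := Good (Function.update a σ v)`, closure = `hGgen`'s (zero)(add)(smul)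
(deriv)(congr) read at the place `σ` — R90-C10-p03 (g0)'s assembly side).  THIS FILE is the skeleton both halves `exact` into, typed generically (no Schwartz
space, no Weil representation): an index type `Ω` of places (`Fintype`, `DecidableEq`), data types `D : Ω → Type*`, vacua `φ : Π σ, D σ`, a property `Good`.
* §1 **`forall_of_vacuum_of_placeStep`** — (base) `Good φ` + (step) `∀ σ a, Good (update a σ (φ σ)) → Good a` ⇒ `∀ a, Good a` (induction on the finset of
  places where `a` differs from `φ`; `Finset.induction_on`);
* §2 **`forall_of_vacuum_of_placeStep'`** — the same with the step in «frozen rest» form `∀ σ rest v, Good (update rest σ (φ σ)) → Good (update rest σ v)`,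
  and **`forall_of_vacuum_of_placeLift`** — the step supplied as a ONE-PLACE INDUCTION PRINCIPLE per place (the literal shape of ★ (E-f): for every place `σ`
  and frozen `rest`, every predicate `P` on `D σ` in a designated class `Adm σ rest` holding at `φ σ` holds everywhere; with `(fun v => Good (update rest σ v)) ∈ Adm σ rest`).
* §3 (ED. 2) **`forall_tuple_of_fockLetters`** — B3-core ∘ ★ (E-f): the place-tuple induction with the one-place lift DISCHARGED by `induction_on_kFinite_fun`
  (polynomial-slot tuples `D σ := A σ` the Fock polynomials at `σ`, `φ σ := 1`, `B := id`): hypotheses = the (E-b)(FFT)(RED) letters AT EVERY PLACE (the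
  section map `SW σ rest` may depend on the frozen rest) + the closure of `v ↦ Good (update rest σ v)` under `0, +, •`, the `Ap σ i ∕ Am σ i`, and `SW σ rest`-
  invariance + `Good (fun _ => 1)` ⇒ `∀ a, Good a`.  THIS is the shape B3-b (R90-C10-p03 (g0) ∕ K2Liu-p11 (g4)) discharges (design of record 23:26Z).
* §4 (ED. 3) **`pivot_of_archPin_of_siegel`** (`_symm`), **`scalarMatch_of_vacuum_ne_zero`** — the pure algebra of the (E-d) pivot: (P-arch)'s one-functional law
  `S a (H·x_k) = η_k · ℓ (tens (κ_k Φ₁) Φ₂)` + Siegel semi-invariance `S a (H·x_k) = χ_k · S a H` + the scalar match `χ_k = η_k · vac_k` ⇒ `S a′ H = vac_k · S a H`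
  (= `hpiv` of ★ `K2LiuLocalThetaReduction.hRED_of_pivot`, pointwise in `H`); and conversely the scalar match from ONE non-vanishing vacuum section.
References: [Howe1989, §3]; [KudlaRallis1994, §3] (citations only — the file is finite combinatorics).
HONEST LABEL: HC_CM is proved only modulo the 7 printed citations (2 remaining named inputs: hLiu418 = stmt-HodgeConjecture-24832,
h413 = stmt-HodgeConjecture-24833) until rung 0 closes; count-neutral helper, closes no socket.
-/

set_option autoImplicit false
set_option linter.dupNamespace false -- the mandated namespace repeats `HodgeConjecture.HodgeConjecture`

namespace Summit.HodgeConjecture.HodgeConjecture.Cruxes.HLiu418.K2LiuArchSWDataInductionCore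

variable {Ω : Type*} [DecidableEq Ω] {D : Ω → Type*} (φ : (σ : Ω) → D σ) (Good : ((σ : Ω) → D σ) → Prop)

/-! ## §1 The place-finset induction -/

/-- **INDUCTION OVER THE PLACES WHERE THE TUPLE IS NOT THE VACUUM.**  If `Good φ` and, at every place `σ`, `Good` passes from the tuple with the vacuum at `σ`
to the tuple itself, then `Good a` for every tuple `a` agreeing with `φ` off a finite set `T` — induction on `T`. [folklore] -/
theorem forall_of_vacuum_of_placeStep_finset (hbase : Good φ)
    (hstep : ∀ (σ : Ω) (a : (σ : Ω) → D σ), Good (Function.update a σ (φ σ)) → Good a)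
    (T : Finset Ω) : ∀ a : (σ : Ω) → D σ, (∀ σ, σ ∉ T → a σ = φ σ) → Good a := by
  induction T using Finset.induction_on with
  | empty =>
    intro a ha
    have h : a = φ := funext fun σ => ha σ (Finset.notMem_empty σ)
    rw [h]
    exact hbase
  | insert σ T hσT ih =>
    intro a ha
    refine hstep σ a (ih _ fun τ hτ => ?_)
    by_cases hτσ : τ = σ
    · subst hτσ
      simp only [Function.update_self]
    · rw [Function.update_of_ne hτσ]
      exact ha τ fun h => (Finset.mem_insert.1 h).elim hτσ hτ

/-- **THE PLACE-FINSET INDUCTION** (finitely many places): (base) `Good φ` + (step) at each place ⇒ `Good a` for EVERY tuple `a`. [folklore] -/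
theorem forall_of_vacuum_of_placeStep [Fintype Ω] (hbase : Good φ)
    (hstep : ∀ (σ : Ω) (a : (σ : Ω) → D σ), Good (Function.update a σ (φ σ)) → Good a) (a : (σ : Ω) → D σ) : Good a :=
  forall_of_vacuum_of_placeStep_finset φ Good hbase hstep Finset.univ a fun σ hσ => (hσ (Finset.mem_univ σ)).elim

/-! ## §2 The step in «frozen rest» form and as a one-place induction principle -/

/-- **FROZEN-REST FORM**: the step stated as «at place `σ`, with the other places frozen at `rest`, `Good` passes from the vacuum to every one-place datum `v`».
[folklore] -/
theorem forall_of_vacuum_of_placeStep' [Fintype Ω] (hbase : Good φ)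
    (hstep : ∀ (σ : Ω) (rest : (σ : Ω) → D σ) (v : D σ), Good (Function.update rest σ (φ σ)) → Good (Function.update rest σ v))
    (a : (σ : Ω) → D σ) : Good a := by
  refine forall_of_vacuum_of_placeStep φ Good hbase (fun σ a h => ?_) a
  have h' := hstep σ a (a σ) h
  rwa [Function.update_eq_self] at h'

/-- **THE STEP AS A ONE-PLACE INDUCTION PRINCIPLE (the literal shape of ★ (E-f) `induction_on_kFinite`).**  Suppose that at every place `σ` and for every frozen
`rest`, every predicate `P` on one-place data belonging to a designated class `Adm σ rest` (closure under the σ-slot operations: `0, +, •`, the `𝔭^±_σ`, SW_σ-invariance)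
and holding at the vacuum `φ σ` holds at every datum; and suppose `v ↦ Good (update rest σ v)` belongs to that class.  Then (base) `Good φ` ⇒ `Good a` for all `a`.
[cite: Howe1989, §3] -/
theorem forall_of_vacuum_of_placeLift [Fintype Ω] (Adm : (σ : Ω) → ((σ : Ω) → D σ) → (D σ → Prop) → Prop)
    (hlift : ∀ (σ : Ω) (rest : (σ : Ω) → D σ) (P : D σ → Prop), Adm σ rest P → P (φ σ) → ∀ v, P v)
    (hadm : ∀ (σ : Ω) (rest : (σ : Ω) → D σ), Adm σ rest (fun v => Good (Function.update rest σ v)))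
    (hbase : Good φ) (a : (σ : Ω) → D σ) : Good a :=
  forall_of_vacuum_of_placeStep' φ Good hbase (fun σ rest v h => hlift σ rest _ (hadm σ rest) h v) a

/-- **RELATIVE FORM (a sub-family of tuples)**: the same for tuples drawn from prescribed one-place families `S σ ∋ φ σ` (e.g. Fock-finite data), when the step only
moves inside the families. [folklore] -/
theorem forall_of_vacuum_of_placeStep_of_mem [Fintype Ω] (S : (σ : Ω) → Set (D σ)) (hφ : ∀ σ, φ σ ∈ S σ)
    (hbase : Good φ)
    (hstep : ∀ (σ : Ω) (rest : (σ : Ω) → D σ), (∀ τ, rest τ ∈ S τ) → ∀ v ∈ S σ,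
      Good (Function.update rest σ (φ σ)) → Good (Function.update rest σ v))
    (a : (σ : Ω) → D σ) (ha : ∀ σ, a σ ∈ S σ) : Good a := by
  have key := forall_of_vacuum_of_placeStep φ (fun b => (∀ σ, b σ ∈ S σ) → Good b) (fun _ => hbase) ?_ a
  · exact key ha
  · intro σ b hb hbS
    have hbS' : ∀ τ, Function.update b σ (φ σ) τ ∈ S τ := fun τ => by
      by_cases hτσ : τ = σ
      · subst hτσ
        simp only [Function.update_self]
        exact hφ τ
      · rw [Function.update_of_ne hτσ]
        exact hbS τ
    have h := hstep σ b hbS (b σ) (hbS σ) (hb hbS')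
    rwa [Function.update_eq_self] at h

/-! ## §3 (ED. 2) The place-tuple induction with the one-place lift discharged by ★ (E-f) (polynomial-slot tuples) -/

section FockTuples

variable {Ω : Type*} [Fintype Ω] [DecidableEq Ω] {A : Ω → Type*} [∀ σ, CommRing (A σ)] [∀ σ, Algebra ℂ (A σ)]
  {ι : Ω → Type*} {G : Ω → Type*} {W : Ω → Type*} [∀ σ, AddCommGroup (W σ)] [∀ σ, Module ℂ (W σ)]
  (CR CS : (σ : Ω) → ι σ → A σ) (Ap Am : (σ : Ω) → ι σ → A σ →ₗ[ℂ] A σ) (c₁ c₃ : Ω → ℂ)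
  (subst : (σ : Ω) → G σ → A σ →ₗ[ℂ] A σ)
  (SW : (σ : Ω) → ((τ : Ω) → A τ) → A σ →ₗ[ℂ] W σ)
  (Good : ((σ : Ω) → A σ) → Prop)

/-- **B3, GENERIC FORM: THE PLACE-TUPLE INDUCTION FROM THE ONE-PLACE FOCK LETTERS.**  Data per real place `σ`: the Fock polynomial algebra `A σ`, contractions
`CR σ, CS σ`, the `𝔭^±` symbols `Ap σ, Am σ` with the ★ (E-c) letters (hAm)(hAp) (scalars `c₁ σ, c₃ σ ≠ 0`), substitutions `subst σ` with the first fundamental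
theorem (FFT), and for every frozen tuple `rest` a linear section map `SW σ rest : A σ →ₗ W σ` with the reduction (RED).  Let `Good` be a property of tuples such
that, at every place `σ` and for every frozen `rest`, `v ↦ Good (update rest σ v)` is closed under `0, +, •`, under the `Ap σ i`, `Am σ i`, and under «same section»
for `SW σ rest`; and `Good (fun _ => 1)` (the all-vacuum tuple).  Then `Good a` for EVERY tuple `a`.  (★ `forall_of_vacuum_of_placeStep'` with the step = ★ (E-f)
`induction_on_kFinite_fun` at `B := LinearMap.id`.) [cite: Howe1989, §3] [cite: KudlaRallis1994, §3] -/
theorem forall_tuple_of_fockLetters (hc₁ : ∀ σ, c₁ σ ≠ 0) (hc₃ : ∀ σ, c₃ σ ≠ 0)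
    (hAm : ∀ σ (τ : List (ι σ)) (i : ι σ), Am σ i ((τ.map (CS σ)).prod) = c₃ σ • (CS σ i * (τ.map (CS σ)).prod))
    (hAp : ∀ σ (ρ τ : List (ι σ)) (i : ι σ),
      Ap σ i ((ρ.map (CR σ)).prod * (τ.map (CS σ)).prod) - c₁ σ • (CR σ i * (ρ.map (CR σ)).prod * (τ.map (CS σ)).prod) ∈
        Submodule.span ℂ {x : A σ | ∃ τ' : List (ι σ), τ'.length < τ.length ∧ x = (ρ.map (CR σ)).prod * (τ'.map (CS σ)).prod})
    (hFFT : ∀ σ (F : A σ), (∀ g, subst σ g F = F) →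
      F ∈ Submodule.span ℂ {x : A σ | ∃ ρ τ : List (ι σ), x = (ρ.map (CR σ)).prod * (τ.map (CS σ)).prod})
    (hRED : ∀ σ (rest : (τ : Ω) → A τ) (F : A σ), ∃ F₀ : A σ, (∀ g, subst σ g F₀ = F₀) ∧ SW σ rest F = SW σ rest F₀)
    (h0 : ∀ σ (rest : (τ : Ω) → A τ), Good (Function.update rest σ 0))
    (hadd : ∀ σ (rest : (τ : Ω) → A τ) (v w : A σ),
      Good (Function.update rest σ v) → Good (Function.update rest σ w) → Good (Function.update rest σ (v + w)))
    (hsmul : ∀ σ (rest : (τ : Ω) → A τ) (c : ℂ) (v : A σ), Good (Function.update rest σ v) → Good (Function.update rest σ (c • v)))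
    (hAp_good : ∀ σ (rest : (τ : Ω) → A τ) (i : ι σ) (v : A σ), Good (Function.update rest σ v) → Good (Function.update rest σ (Ap σ i v)))
    (hAm_good : ∀ σ (rest : (τ : Ω) → A τ) (i : ι σ) (v : A σ), Good (Function.update rest σ v) → Good (Function.update rest σ (Am σ i v)))
    (hsec : ∀ σ (rest : (τ : Ω) → A τ) (v v' : A σ), SW σ rest v = SW σ rest v' →
      Good (Function.update rest σ v) → Good (Function.update rest σ v'))
    (hbase : Good (fun _ => 1)) (a : (σ : Ω) → A σ) : Good a := by
  refine forall_of_vacuum_of_placeStep' (fun _ => (1 : A _)) Good hbase (fun σ rest v hv => ?_) a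
  -- the one-place lift at `σ` with the rest frozen: ★ (E-f) `induction_on_kFinite_fun` at `B := id`
  have key := K2LiuLocalThetaCyclicUniform.induction_on_kFinite_fun (CR σ) (CS σ) (Ap σ) (Am σ) (LinearMap.id : A σ →ₗ[ℂ] A σ)
    (subst σ) (SW σ rest) (fun i => ⇑(Ap σ i)) (fun i => ⇑(Am σ i)) (hc₁ σ) (hc₃ σ) (hAm σ) (hAp σ)
    (fun _ _ => rfl) (fun _ _ => rfl) (hFFT σ) (hRED σ rest)
    (Good := fun v => Good (Function.update rest σ v))
    (h0 σ rest) (hadd σ rest) (hsmul σ rest) (by simpa using hv) (hAp_good σ rest) (hAm_good σ rest) (hsec σ rest) v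
  simpa using key

end FockTuples

/-! ## §4 (ED. 3) The pivot algebra: (P-arch)'s `ℓ′`-law + Siegel semi-invariance + the scalar match ⇒ the see-saw pivot `hpiv` -/

section PivotAlgebra

/-- **THE (E-d) PIVOT FROM ITS THREE LETTERS** (pure algebra — the logic of the chain (π0)–(π3) of the F4 desk word 2026-09-04T23:42:50Z): let `S a g` be a
section (`a` the global archimedean datum, `g` in the big group), `x k` the big-group element of `k ∈ K_H` at the place (`x 1 = 1`), `κ k` the one-place operator
(`κ 1 = id`), `η` the archimedean twist (`η 1 = 1`, `η k ≠ 0`), `tens Φ₁ Φ₂` the slot decomposition read through `J`.  IF (P-arch) «`S a (H * x k) = η k * ℓ (tens (κ k Φ₁) Φ₂)`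
whenever `J a = tens Φ₁ Φ₂`» (ONE functional `ℓ` for all `k, Φ₁, Φ₂, a`; ★ `K2LiuArchRightLegPlacePin.exists_clm_swSection_mul_placeSecJ_kH_eq`), (Siegel) «`S a (H * x k) =
χ k * S a H`» (★ `swSection_mul_right` + ★ `swSectionTensor_omega_partnerEmb_eq_mul` after (R-grp)), and (scalar match) «`χ k = η k * vac k`» ((R-scal)), THEN
`S a′ H = vac k * S a H` whenever `J a = tens Φ₁ Φ₂` and `J a′ = tens (κ k Φ₁) Φ₂` — pointwise in `H`, this is the pivot `hpiv` of ★ `K2LiuLocalThetaReduction.hRED_of_pivot`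
for the slot functional `Φ₁ ↦ (h ↦ S (J⁻¹ (tens Φ₁ Φ₂)) (tensorEmb h))`. [folklore] -/
theorem pivot_of_archPin_of_siegel {K G A B V V₂ : Type*} [MulOneClass G] [One K]
    (S : A → G → ℂ) (J : A → B) (tens : V → V₂ → B) (x : K → G) (κ : K → V → V) (η χ vac : K → ℂ) (H : G) (ℓ : B → ℂ)
    (hx1 : x 1 = 1) (hκ1 : ∀ Φ, κ 1 Φ = Φ) (hη1 : η 1 = 1) (hη : ∀ k, η k ≠ 0)
    (hP : ∀ (k : K) (Φ₁ : V) (Φ₂ : V₂) (a : A), J a = tens Φ₁ Φ₂ → S a (H * x k) = η k * ℓ (tens (κ k Φ₁) Φ₂))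
    (hq : ∀ (k : K) (a : A), S a (H * x k) = χ k * S a H) (hscal : ∀ k, χ k = η k * vac k)
    (k : K) (Φ₁ : V) (Φ₂ : V₂) (a a' : A) (ha : J a = tens Φ₁ Φ₂) (ha' : J a' = tens (κ k Φ₁) Φ₂) :
    S a' H = vac k * S a H := by
  -- `ℓ` IS the section at `H`: (P-arch) at `k := 1` for `a′`
  have h1 : S a' H = ℓ (tens (κ k Φ₁) Φ₂) := by
    have h := hP 1 (κ k Φ₁) Φ₂ a' ha'
    rwa [hx1, mul_one, hη1, one_mul, hκ1] at h
  -- (P-arch) at `k` for `a`, then (Siegel) and the scalar match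
  have h2 : η k * ℓ (tens (κ k Φ₁) Φ₂) = η k * (vac k * S a H) := by
    rw [← hP k Φ₁ Φ₂ a ha, hq k a, hscal k, mul_assoc]
  rw [h1]
  exact mul_left_cancel₀ (hη k) h2

/-- **… with the slot map an equivalence** (`a := J⁻¹ (tens Φ₁ Φ₂)`, `a′ := J⁻¹ (tens (κ k Φ₁) Φ₂)`): `S (J⁻¹ (tens (κ k Φ₁) Φ₂)) H = vac k * S (J⁻¹ (tens Φ₁ Φ₂)) H`.
[folklore] -/
theorem pivot_of_archPin_of_siegel_symm {K G A B V V₂ : Type*} [MulOneClass G] [One K]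
    (S : A → G → ℂ) (J : A ≃ B) (tens : V → V₂ → B) (x : K → G) (κ : K → V → V) (η χ vac : K → ℂ) (H : G) (ℓ : B → ℂ)
    (hx1 : x 1 = 1) (hκ1 : ∀ Φ, κ 1 Φ = Φ) (hη1 : η 1 = 1) (hη : ∀ k, η k ≠ 0)
    (hP : ∀ (k : K) (Φ₁ : V) (Φ₂ : V₂) (a : A), J a = tens Φ₁ Φ₂ → S a (H * x k) = η k * ℓ (tens (κ k Φ₁) Φ₂))
    (hq : ∀ (k : K) (a : A), S a (H * x k) = χ k * S a H) (hscal : ∀ k, χ k = η k * vac k)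
    (k : K) (Φ₁ : V) (Φ₂ : V₂) :
    S (J.symm (tens (κ k Φ₁) Φ₂)) H = vac k * S (J.symm (tens Φ₁ Φ₂)) H :=
  pivot_of_archPin_of_siegel S J tens x κ η χ vac H ℓ hx1 hκ1 hη1 hη hP hq hscal k Φ₁ Φ₂ _ _ (J.apply_symm_apply _) (J.apply_symm_apply _)

/-- **THE SCALAR MATCH IS FORCED BY ONE NON-VANISHING** (the convention-proof route to (R-scal)): under (P-arch) and (Siegel) as above, if the vacuum slot `Φ°`
is a `κ`-eigenvector `κ k Φ° = vac k • Φ°`-wise inside `tens` — i.e. `tens (κ k Φ°) Φ₂ = tens Φ° Φ₂` is replaced by the scalar law `ℓ (tens (κ k Φ°) Φ₂) = vac k * ℓ (tens Φ° Φ₂)`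
— and the section of the vacuum datum does not vanish at `H`, then `χ k = η k * vac k`. [folklore] -/
theorem scalarMatch_of_vacuum_ne_zero {K G A B V V₂ : Type*} [MulOneClass G] [One K]
    (S : A → G → ℂ) (J : A → B) (tens : V → V₂ → B) (x : K → G) (κ : K → V → V) (η χ vac : K → ℂ) (H : G) (ℓ : B → ℂ)
    (hx1 : x 1 = 1) (hκ1 : ∀ Φ, κ 1 Φ = Φ) (hη1 : η 1 = 1)
    (hP : ∀ (k : K) (Φ₁ : V) (Φ₂ : V₂) (a : A), J a = tens Φ₁ Φ₂ → S a (H * x k) = η k * ℓ (tens (κ k Φ₁) Φ₂))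
    (hq : ∀ (k : K) (a : A), S a (H * x k) = χ k * S a H)
    (Φ₀ : V) (Φ₂ : V₂) (a₀ : A) (ha₀ : J a₀ = tens Φ₀ Φ₂) (hvac : ∀ k, ℓ (tens (κ k Φ₀) Φ₂) = vac k * ℓ (tens Φ₀ Φ₂))
    (hne : S a₀ H ≠ 0) (k : K) : χ k = η k * vac k := by
  -- `ℓ (tens Φ₀ Φ₂) = S a₀ H` ((P-arch) at `k := 1`)
  have h1 : S a₀ H = ℓ (tens Φ₀ Φ₂) := by
    have h := hP 1 Φ₀ Φ₂ a₀ ha₀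
    rwa [hx1, mul_one, hη1, one_mul, hκ1] at h
  have h2 : χ k * S a₀ H = η k * vac k * S a₀ H := by
    rw [← hq k a₀, hP k Φ₀ Φ₂ a₀ ha₀, hvac k, h1, mul_assoc]
  exact mul_right_cancel₀ hne h2

end PivotAlgebra

end Summit.HodgeConjecture.HodgeConjecture.Cruxes.HLiu418.K2LiuArchSWDataInductionCore
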